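import Summits.SmoothPoincare4.SmoothPoincare4.Theses.SblfDescent

/-!
# `StepTwo` — the natural strengthening "destabilise in place" is false (crux stmt-SmoothPoincare4-18529)

Crux `SblfDescent.StepTwo` trades a simplified broken Lefschetz fibration of lower genus 1 on a
homotopy 4-sphere `M` for one of lower genus 0.  The route reads the genus of a regular fibre `F_y`
of `f : M → S²` as `H₁(F_y; ℤ) ≅ ℤ^(2n)` (Mathlib singular homology).  cdisprove seat.

* `genusReading_unique`: the reading is exclusive — `ℤ^(2n) ≅ H ≅ ℤ^(2m)` forces `n = m` (invariant
  basis number of `ℤ`), so "genus `h + 1` or `h`" in the route's predicate is a genuine dichotomy.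
* `lowerGenus_unique` / `sameMap_lowerGenus_eq`: the LOWER GENUS IS A FUNCTION OF THE MAP `f` —
  SBLF data of lower genera `h` and `h'` over one map force `h = h'` (any orientations, any
  Lefschetz sets); every rung of the ladder must change the fibration map.
* `not_destabilise_inPlace`: in particular NO SINGLE MAP `f` can witness both rungs of `StepTwo`: the genus-2 datum provides a
  regular value whose fibre has `H₁ ≅ ℤ⁴`, while the genus-1 datum reads every regular fibre of the
  same map as a torus or a sphere.  Whatever the orientations and Lefschetz sets, the conjuncts
  "∃ higher-genus regular value" (at lower genus 1) and "every regular fibre has genus 1 or 0"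
  (at lower genus 0) are jointly unsatisfiable — `not_sameMap_witness` is the verbatim form over the
  route's predicate.  Any proof of `StepTwo` must construct a NEW fibration map (flip-and-slip /
  Hurwitz moves change `f`), never re-read the given one.
-/

noncomputable section

-- the prescribed namespace `Summit.<P>.<Sub>.…` duplicates `SmoothPoincare4` (P = Sub)
set_option linter.dupNamespace false

open scoped Manifold ContDiff Topology ContinuousMap

namespace Summit.SmoothPoincare4.SmoothPoincare4.Theorems.StepTwo.Negative

/-- **The genus reading is exclusive**: two trivialisations `ℤ^(2n) ≃ H`, `ℤ^(2m) ≃ H` of one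
`ℤ`-module force `n = m` (invariant basis number). [folklore] -/
theorem genusReading_unique {H : Type*} [AddCommGroup H] [Module ℤ H] {n m : ℕ}
    (e₁ : (Fin (2 * n) → ℤ) ≃ₗ[ℤ] H) (e₂ : (Fin (2 * m) → ℤ) ≃ₗ[ℤ] H) : n = m := by
  have h := (e₁.trans e₂.symm).finrank_eq
  simp only [Module.finrank_fin_fun] at h
  omega

/-- **No destabilisation in place** (conjunct form).  For one map `f : M → S²`: a regular value with
fibre of genus 2 (conjunct "∃ higher-genus regular value" of the lower-genus-1 datum) contradicts
"every regular fibre is connected of genus 1 or 0" (fibre conjunct of the lower-genus-0 datum).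
[folklore] -/
theorem not_destabilise_inPlace {M : Type} [TopologicalSpace M]
    [ChartedSpace (EuclideanSpace ℝ (Fin 4)) M] (f : M → (Metric.sphere (0 : EuclideanSpace ℝ (Fin 3)) 1))
    (h1 : ∃ y, (∀ q, f q = y → Function.Surjective (mfderiv (𝓡 4) (𝓡 2) f q)) ∧
      Nonempty ((Fin (2 * (1 + 1)) → ℤ) ≃ₗ[ℤ] Literature.AlgebraicTopology.SingularHomology.singularHomology ℤ ℤ ↥(f ⁻¹' {y}) 1))
    (h0 : ∀ y, (∀ q, f q = y → Function.Surjective (mfderiv (𝓡 4) (𝓡 2) f q)) →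
      IsConnected (f ⁻¹' {y}) ∧
        (Nonempty ((Fin (2 * (0 + 1)) → ℤ) ≃ₗ[ℤ] Literature.AlgebraicTopology.SingularHomology.singularHomology ℤ ℤ ↥(f ⁻¹' {y}) 1) ∨
          Nonempty ((Fin (2 * 0) → ℤ) ≃ₗ[ℤ] Literature.AlgebraicTopology.SingularHomology.singularHomology ℤ ℤ ↥(f ⁻¹' {y}) 1))) :
    False := by
  obtain ⟨y, hy, ⟨e₂⟩⟩ := h1
  obtain ⟨-, h01 | h00⟩ := h0 y hy
  · obtain ⟨e₁⟩ := h01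
    have := genusReading_unique e₂ e₁
    omega
  · obtain ⟨e₀⟩ := h00
    have := genusReading_unique e₂ e₀
    omega

/-- **The lower genus is a function of the map** (conjunct form).  For one map `f : M → S²` and
two lower genera `h, h'`: the conjuncts "∃ regular value of genus `h + 1`" and "every regular fibre
has genus `h' + 1` or `h'`" (and symmetrically) force `h = h'`. [folklore] -/
theorem lowerGenus_unique {M : Type} [TopologicalSpace M]
    [ChartedSpace (EuclideanSpace ℝ (Fin 4)) M] (f : M → (Metric.sphere (0 : EuclideanSpace ℝ (Fin 3)) 1)) {h h' : ℕ}
    (h8 : ∃ y, (∀ q, f q = y → Function.Surjective (mfderiv (𝓡 4) (𝓡 2) f q)) ∧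
      Nonempty ((Fin (2 * (h + 1)) → ℤ) ≃ₗ[ℤ] Literature.AlgebraicTopology.SingularHomology.singularHomology ℤ ℤ ↥(f ⁻¹' {y}) 1))
    (h7' : ∀ y, (∀ q, f q = y → Function.Surjective (mfderiv (𝓡 4) (𝓡 2) f q)) →
      IsConnected (f ⁻¹' {y}) ∧
        (Nonempty ((Fin (2 * (h' + 1)) → ℤ) ≃ₗ[ℤ] Literature.AlgebraicTopology.SingularHomology.singularHomology ℤ ℤ ↥(f ⁻¹' {y}) 1) ∨
          Nonempty ((Fin (2 * h') → ℤ) ≃ₗ[ℤ] Literature.AlgebraicTopology.SingularHomology.singularHomology ℤ ℤ ↥(f ⁻¹' {y}) 1)))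
    (h8' : ∃ y, (∀ q, f q = y → Function.Surjective (mfderiv (𝓡 4) (𝓡 2) f q)) ∧
      Nonempty ((Fin (2 * (h' + 1)) → ℤ) ≃ₗ[ℤ] Literature.AlgebraicTopology.SingularHomology.singularHomology ℤ ℤ ↥(f ⁻¹' {y}) 1))
    (h7 : ∀ y, (∀ q, f q = y → Function.Surjective (mfderiv (𝓡 4) (𝓡 2) f q)) →
      IsConnected (f ⁻¹' {y}) ∧
        (Nonempty ((Fin (2 * (h + 1)) → ℤ) ≃ₗ[ℤ] Literature.AlgebraicTopology.SingularHomology.singularHomology ℤ ℤ ↥(f ⁻¹' {y}) 1) ∨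
          Nonempty ((Fin (2 * h) → ℤ) ≃ₗ[ℤ] Literature.AlgebraicTopology.SingularHomology.singularHomology ℤ ℤ ↥(f ⁻¹' {y}) 1))) :
    h = h' := by
  obtain ⟨y, hy, ⟨e⟩⟩ := h8
  obtain ⟨y', hy', ⟨e'⟩⟩ := h8'
  obtain ⟨-, ha | hb⟩ := h7' y hy
  · obtain ⟨a⟩ := ha
    have := genusReading_unique e a
    omega
  · obtain ⟨b⟩ := hb
    have h₁ := genusReading_unique e b
    obtain ⟨-, hc | hd⟩ := h7 y' hy'
    · obtain ⟨c⟩ := hc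
      have := genusReading_unique e' c
      omega
    · obtain ⟨d⟩ := hd
      have := genusReading_unique e' d
      omega

/-- **The lower genus is a function of the map** (verbatim form over the route's predicate): if one
map `f` underlies SBLF data of lower genus `h` and of lower genus `h'` (any orientations, any
Lefschetz sets), then `h = h'` — so every rung of the ladder `StepTwo` / `StepGE3` must change the
fibration map. [folklore] -/
theorem sameMap_lowerGenus_eq {M : Type} [TopologicalSpace M]
    [ChartedSpace (EuclideanSpace ℝ (Fin 4)) M] [IsManifold (𝓡 4) ∞ M]
    (o o' : Literature.Topology.FourManifolds.SmoothOrientation (𝓡 4) M)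
    (f : M → (Metric.sphere (0 : EuclideanSpace ℝ (Fin 3)) 1)) (L L' : Finset M) {h h' : ℕ}
    (hh : let R : M → Prop := fun q => Function.Surjective (mfderiv (𝓡 4) (𝓡 2) f q); let G : (Metric.sphere (0 : EuclideanSpace ℝ (Fin 3)) 1) → ℕ → Prop := fun y n => Nonempty ((Fin (2 * n) → ℤ) ≃ₗ[ℤ] Literature.AlgebraicTopology.SingularHomology.singularHomology ℤ ℤ ↥(f ⁻¹' {y}) 1); ContMDiff (𝓡 4) (𝓡 2) ((⊤ : ℕ∞) : WithTop ℕ∞) f ∧ Function.Surjective f ∧ (∀ p ∈ L, Literature.Topology.FourManifolds.IsLefschetzCriticalPoint (𝓡 4) (𝓡 2) o f p true) ∧ (∀ p : M, ¬ R p → p ∉ L → ∃ (φ : OpenPartialHomeomorph M (EuclideanSpace ℝ (Fin 4))) (ψ : OpenPartialHomeomorph (Metric.sphere (0 : EuclideanSpace ℝ (Fin 3)) 1) (EuclideanSpace ℝ (Fin 2))), p ∈ φ.source ∧ φ p = 0 ∧ Set.MapsTo f φ.source ψ.source ∧ ContMDiffOn (𝓡 4) (𝓡 4) ((⊤ : ℕ∞)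 : WithTop ℕ∞) φ φ.source ∧ ContMDiffOn (𝓡 4) (𝓡 4) ((⊤ : ℕ∞) : WithTop ℕ∞) φ.symm φ.target ∧ ContMDiffOn (𝓡 2) (𝓡 2) ((⊤ : ℕ∞) : WithTop ℕ∞) ψ ψ.source ∧ ContMDiffOn (𝓡 2) (𝓡 2) ((⊤ : ℕ∞) : WithTop ℕ∞) ψ.symm ψ.target ∧ ∀ q ∈ φ.source, (ψ (f q)) 0 = (φ q) 0 ∧ (ψ (f q)) 1 = (φ q) 1 ^ 2 + (φ q) 2 ^ 2 - (φ q) 3 ^ 2) ∧ IsConnected ({p : M | ¬ R p} \ (↑L : Set M)) ∧ Set.InjOn f {p : M | ¬ R p} ∧ (∀ y, (∀ q, f q = y → R q) → IsConnected (f ⁻¹' {y}) ∧ (G y (h + 1) ∨ G y (h))) ∧ (∃ y, (∀ q, f q = y → R q) ∧ G y (h + 1)) ∧ (∃ y, (∀ q, f q = y → R q) ∧ G y (h)) ∧ (∀ p ∈ L, ∀ᶠ y in nhds (f p), (∀ q, f q = y → R q) → G y (h + 1)))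
    (hh' : let R : M → Prop := fun q => Function.Surjective (mfderiv (𝓡 4) (𝓡 2) f q); let G : (Metric.sphere (0 : EuclideanSpace ℝ (Fin 3)) 1) → ℕ → Prop := fun y n => Nonempty ((Fin (2 * n) → ℤ) ≃ₗ[ℤ] Literature.AlgebraicTopology.SingularHomology.singularHomology ℤ ℤ ↥(f ⁻¹' {y}) 1); ContMDiff (𝓡 4) (𝓡 2) ((⊤ : ℕ∞) : WithTop ℕ∞) f ∧ Function.Surjective f ∧ (∀ p ∈ L', Literature.Topology.FourManifolds.IsLefschetzCriticalPoint (𝓡 4) (𝓡 2) o' f p true) ∧ (∀ p : M, ¬ R p → p ∉ L' → ∃ (φ : OpenPartialHomeomorph M (EuclideanSpace ℝ (Fin 4))) (ψ : OpenPartialHomeomorph (Metric.sphere (0 : EuclideanSpace ℝ (Fin 3)) 1) (EuclideanSpace ℝ (Fin 2))), p ∈ φ.source ∧ φ p = 0 ∧ Set.MapsTo f φ.source ψ.source ∧ ContMDiffOn (𝓡 4) (𝓡 4) ((⊤ : ℕ∞) : WithTop ℕ∞) φ φ.source ∧ ContMDiffOn (𝓡 4) (𝓡 4) ((⊤ : ℕ∞)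 : WithTop ℕ∞) φ.symm φ.target ∧ ContMDiffOn (𝓡 2) (𝓡 2) ((⊤ : ℕ∞) : WithTop ℕ∞) ψ ψ.source ∧ ContMDiffOn (𝓡 2) (𝓡 2) ((⊤ : ℕ∞) : WithTop ℕ∞) ψ.symm ψ.target ∧ ∀ q ∈ φ.source, (ψ (f q)) 0 = (φ q) 0 ∧ (ψ (f q)) 1 = (φ q) 1 ^ 2 + (φ q) 2 ^ 2 - (φ q) 3 ^ 2) ∧ IsConnected ({p : M | ¬ R p} \ (↑L' : Set M)) ∧ Set.InjOn f {p : M | ¬ R p} ∧ (∀ y, (∀ q, f q = y → R q) → IsConnected (f ⁻¹' {y}) ∧ (G y (h' + 1) ∨ G y (h'))) ∧ (∃ y, (∀ q, f q = y → R q) ∧ G y (h' + 1)) ∧ (∃ y, (∀ q, f q = y → R q) ∧ G y (h')) ∧ (∀ p ∈ L', ∀ᶠ y in nhds (f p), (∀ q, f q = y → R q) → G y (h' + 1))) :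
    h = h' :=
  lowerGenus_unique f hh.2.2.2.2.2.2.2.1 hh'.2.2.2.2.2.2.1 hh'.2.2.2.2.2.2.2.1 hh.2.2.2.2.2.2.1

/-- **No destabilisation in place** (verbatim form over the route's predicate): the lower-genus-1
and the lower-genus-0 SBLF predicates of `SblfDescent` are never satisfied by a common map `f`,
for any orientations `o, o'` and Lefschetz sets `L, L'`. [folklore] -/
theorem not_sameMap_witness {M : Type} [TopologicalSpace M]
    [ChartedSpace (EuclideanSpace ℝ (Fin 4)) M] [IsManifold (𝓡 4) ∞ M]
    (o o' : Literature.Topology.FourManifolds.SmoothOrientation (𝓡 4) M)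
    (f : M → (Metric.sphere (0 : EuclideanSpace ℝ (Fin 3)) 1)) (L L' : Finset M)
    (h1 : let R : M → Prop := fun q => Function.Surjective (mfderiv (𝓡 4) (𝓡 2) f q); let G : (Metric.sphere (0 : EuclideanSpace ℝ (Fin 3)) 1) → ℕ → Prop := fun y n => Nonempty ((Fin (2 * n) → ℤ) ≃ₗ[ℤ] Literature.AlgebraicTopology.SingularHomology.singularHomology ℤ ℤ ↥(f ⁻¹' {y}) 1); ContMDiff (𝓡 4) (𝓡 2) ((⊤ : ℕ∞) : WithTop ℕ∞) f ∧ Function.Surjective f ∧ (∀ p ∈ L, Literature.Topology.FourManifolds.IsLefschetzCriticalPoint (𝓡 4) (𝓡 2) o f p true) ∧ (∀ p : M, ¬ R p → p ∉ L → ∃ (φ : OpenPartialHomeomorph M (EuclideanSpace ℝ (Fin 4))) (ψ : OpenPartialHomeomorph (Metric.sphere (0 : EuclideanSpace ℝ (Fin 3)) 1) (EuclideanSpace ℝ (Fin 2))), p ∈ φ.source ∧ φ p = 0 ∧ Set.MapsTo f φ.source ψ.source ∧ ContMDiffOn (𝓡 4) (𝓡 4) ((⊤ : ℕ∞) : WithTop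 ℕ∞) φ φ.source ∧ ContMDiffOn (𝓡 4) (𝓡 4) ((⊤ : ℕ∞) : WithTop ℕ∞) φ.symm φ.target ∧ ContMDiffOn (𝓡 2) (𝓡 2) ((⊤ : ℕ∞) : WithTop ℕ∞) ψ ψ.source ∧ ContMDiffOn (𝓡 2) (𝓡 2) ((⊤ : ℕ∞) : WithTop ℕ∞) ψ.symm ψ.target ∧ ∀ q ∈ φ.source, (ψ (f q)) 0 = (φ q) 0 ∧ (ψ (f q)) 1 = (φ q) 1 ^ 2 + (φ q) 2 ^ 2 - (φ q) 3 ^ 2) ∧ IsConnected ({p : M | ¬ R p} \ (↑L : Set M)) ∧ Set.InjOn f {p : M | ¬ R p} ∧ (∀ y, (∀ q, f q = y → R q) → IsConnected (f ⁻¹' {y}) ∧ (G y (1 + 1) ∨ G y (1))) ∧ (∃ y, (∀ q, f q = y → R q) ∧ G y (1 + 1)) ∧ (∃ y, (∀ q, f q = y → R q) ∧ G y (1)) ∧ (∀ p ∈ L, ∀ᶠ y in nhds (f p), (∀ q, f q = y → R q) → G y (1 + 1)))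
    (h0 : let R : M → Prop := fun q => Function.Surjective (mfderiv (𝓡 4) (𝓡 2) f q); let G : (Metric.sphere (0 : EuclideanSpace ℝ (Fin 3)) 1) → ℕ → Prop := fun y n => Nonempty ((Fin (2 * n) → ℤ) ≃ₗ[ℤ] Literature.AlgebraicTopology.SingularHomology.singularHomology ℤ ℤ ↥(f ⁻¹' {y}) 1); ContMDiff (𝓡 4) (𝓡 2) ((⊤ : ℕ∞) : WithTop ℕ∞) f ∧ Function.Surjective f ∧ (∀ p ∈ L', Literature.Topology.FourManifolds.IsLefschetzCriticalPoint (𝓡 4) (𝓡 2) o' f p true) ∧ (∀ p : M, ¬ R p → p ∉ L' → ∃ (φ : OpenPartialHomeomorph M (EuclideanSpace ℝ (Fin 4))) (ψ : OpenPartialHomeomorph (Metric.sphere (0 : EuclideanSpace ℝ (Fin 3)) 1) (EuclideanSpace ℝ (Fin 2))), p ∈ φ.source ∧ φ p = 0 ∧ Set.MapsTo f φ.source ψ.source ∧ ContMDiffOn (𝓡 4) (𝓡 4) ((⊤ : ℕ∞) : WithTop ℕ∞) φ φ.source ∧ ContMDiffOn (𝓡 4) (𝓡 4) ((⊤ : ℕ∞)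 : WithTop ℕ∞) φ.symm φ.target ∧ ContMDiffOn (𝓡 2) (𝓡 2) ((⊤ : ℕ∞) : WithTop ℕ∞) ψ ψ.source ∧ ContMDiffOn (𝓡 2) (𝓡 2) ((⊤ : ℕ∞) : WithTop ℕ∞) ψ.symm ψ.target ∧ ∀ q ∈ φ.source, (ψ (f q)) 0 = (φ q) 0 ∧ (ψ (f q)) 1 = (φ q) 1 ^ 2 + (φ q) 2 ^ 2 - (φ q) 3 ^ 2) ∧ IsConnected ({p : M | ¬ R p} \ (↑L' : Set M)) ∧ Set.InjOn f {p : M | ¬ R p} ∧ (∀ y, (∀ q, f q = y → R q) → IsConnected (f ⁻¹' {y}) ∧ (G y (0 + 1) ∨ G y (0))) ∧ (∃ y, (∀ q, f q = y → R q) ∧ G y (0 + 1)) ∧ (∃ y, (∀ q, f q = y → R q) ∧ G y (0)) ∧ (∀ p ∈ L', ∀ᶠ y in nhds (f p), (∀ q, f q = y → R q) → G y (0 + 1))) :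
    False :=
  not_destabilise_inPlace f h1.2.2.2.2.2.2.2.1 h0.2.2.2.2.2.2.1

end Summit.SmoothPoincare4.SmoothPoincare4.Theorems.StepTwo.Negative

end
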